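import Summits.HodgeConjecture.HodgeConjecture.Theorems.VHCAbelianSchemesRoadWeilLineBlochShifted
import Summits.HodgeConjecture.HodgeConjecture.Theorems.Ring2AbelianAllCMAlgebraicCarriersDefs
import Summits.HodgeConjecture.HodgeConjecture.Theorems.Ring2DeformCompactPencils
import Summits.HodgeConjecture.HodgeConjecture.Theses.VHCAbelianSchemesRoad
import HarnessLib

/-!
# Ring 2 / AbelianAll (André column) — PART AH: `HC_CM` and `HC_AV` from ONE Bloch-semiregular local complete intersection, in a shifted degree,
# at ONE split anchor of our choice per inhabited type (leaf; the route's binders by name)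

research route, not a corollary; conditional on HC_CM plus one named minimal statement.

LEAF FILE (imports the route file `Theses/VHCAbelianSchemesRoad`; nothing should import it). PART AH (gen 65). The route-free engine
`VHCAbelianSchemesRoadWeilLineBlochShifted` proves `AndreSplitWeilClasses` from three inputs: Bloch 1972 Thm. (7.4) for an arbitrary local complete
intersection (the refereed named fact `BlochSemiregularSpreadOfSubscheme n q`, every `(n, q)`), the André ∕ Deligne family fact
`andre1996_weilLineFamily_throughSplitAnchor`, and the find-the-object statement `OneSplitWeilAnchorBlochCarriersAll` (per inhabited type `(E, p)`, `p ≥ 2`: ONE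
split anchor of our choice at every chart of which some non-zero rational `E`-Weil class `w` gives a Bloch-semiregular l.c.i. `Z` of codimension `p + j` with
`[Z] = a·θʲw + b·θ^{p+j}`, `a ≠ 0`, for SOME shift `j` — Lieberman's `B(A)` moving the degree is a theorem of the tree). This leaf reads that at the route's
binders, exactly as PART AF's leaf (`Ring2AbelianAllOneSplitWeilAnchorCarriers` §3–§4) did for the twisted door:

* §1 `HC_CM_of_kodaira_of_bloch_of_throughSplitAnchor_of_oneSplitWeilAnchorBlochCarriersAll` — `HC_CM ⟸ Kodaira ∧ (∀ n q, Bloch (7.4)) ∧ family fact ∧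
  OneSplitWeilAnchorBlochCarriersAll` (Lemme 6.3.2 = André 1992 is CorCM's kernel theorem). NO Chern character theory, NO twisted door, NO K-C on this side.
* §2 `HC_AV_of_kodaira_of_bloch_of_cmAlgebraic_and_oneSplitWeilAnchorBlochCarriers` — THE ANDRÉ COLUMN'S `B_min` OF GEN 65, BLOCH FORM (`HC_CM` IDLE):
  K-C ∧ TwistedPerfectDoor ∧ Kodaira ∧ AndreCMAnchoredPencil (Lemme 6.3.1) ∧ family fact ∧ (∀ n q, Bloch (7.4)) ∧ TWO carrier statements —
  (i) `CMAlgebraicTwistedCarriers` (unchanged: semiregular twisted representatives, modulo the `θ`-ray, of KNOWN ALGEBRAIC classes on polarised CM abelian varieties)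
  and (ii) `OneSplitWeilAnchorBlochCarriersAll`. Compared with gen 63/64 (`…ChartTwistedCarriersAll` ∕ `…FieldChartCarriersAll 𝒪`), conjunct (ii) trades the
  `𝒪`-datum `κ_p = a·w + c·θᵖ` (with `θ`-ray sides in the other degrees of `I`) for a semiregular SUBSCHEME in ANY degree `2(p + j)` with no side conditions;
  neither form implies the other (objects vs subschemes), both are OPEN, both are NOT implied by the Hodge conjecture.
* §3 `HC_CM_and_andreSplitWeilClasses_of_bloch_of_oneSplitWeilAnchorBlochCarriersAll` — both axes at once.

HONEST: every carrier statement is a HYPOTHESIS; the two printed facts enter BY NAME; nothing here says any carrier, `HC_CM`, `HC_AV` or HC holds; `HC_CM` is a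
CONCLUSION of §1 and IDLE in §2, never an input. References: [cite: Bloch1972Semiregularity, Thm. (7.4) and Remark (7.5) (p. 65)] [cite: Andre1996Motifs, §6.3
Lemmes 6.3.1–6.3.3 (pp. 31–33)] [cite: Andre1992HodgeCM, Théorème] [cite: Deligne1982HodgeCycles, §4 proof of Thm. 4.8] [cite: Lieberman1968, main theorem]
[cite: Huybrechts2005, Prop. 5.3.1, Cor. 5.3.3] [cite: Pridham2024Semiregularity, Cor. 2.25 and Rem. 2.26–2.27] [cite: Milne1999, §7 p. 72].
-/

noncomputable section

open CategoryTheory CategoryTheory.Limits AlgebraicGeometry Topology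

namespace Summit.HodgeConjecture.HodgeConjecture.Ring2.AbelianAll

-- the cell's namespace repeats the summit name (`Summit.HodgeConjecture.HodgeConjecture…`), as in every `Ring2*` file
set_option linter.dupNamespace false

open Literature.AlgebraicGeometry Literature.AlgebraicGeometry.Motives
open Literature.AlgebraicGeometry.HodgeTheory
open Literature.AlgebraicGeometry.Deligne1982
open Literature.AlgebraicGeometry.VanGeemen1994 (pullbackOne)
open Literature.AlgebraicTopology.SingularHomology
open Literature.AlgebraicGeometry.Milne1999 (IsOfCMType CMHodgeHypothesisAt)
open Literature.AlgebraicGeometry.Andre1996 (andre1996_cmAnchoredPencil andre1996_weilLineFamily_throughSplitAnchor)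
open Summit.Ventures.HSemireg (ObjClass LocalVariationalHodgeFor)
open Summit.HodgeConjecture.HodgeConjecture.Theses
open Summit.HodgeConjecture.HodgeConjecture.Ring2.SemiregularRepresentatives (AnchoredCarrierAt twistedPerfectDoorVHC_iff_localVariationalHodgeFor
  cmHodgeHypothesisAt_of_kodaira_of_andreSplitWeilClasses forall_hodgeConjectureFor_of_kodaira_of_andre1996_of_andreSplitWeilClasses_of_door_of_cmAlgebraic
  andreSplitWeilClasses_of_throughSplitAnchor_of_bloch_of_oneSplitWeilAnchorBlochCarriersAll)

/-! ## §1 `HC_CM` from Bloch's door -/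

/-- **`HC_CM ⟸ Kodaira ∧ (Bloch (7.4) at every `(n, q)`) ∧ the family fact ∧ OneSplitWeilAnchorBlochCarriersAll`**: the Hodge conjecture for CM abelian varieties
from ONE Bloch-semiregular local complete intersection of codimension `p + j` and class `a·θʲw + b·θ^{p+j}` (`a ≠ 0`, `w` a non-zero rational `E`-Weil class, the shift
`j` free with `2p + j ≤ dim`) on ONE split anchor OF OUR CHOICE per inhabited type `(E, p)`, `p ≥ 2` — André's CM reduction (Lemme 6.3.2 = André 1992) being CorCM's
KERNEL theorem, Kodaira turning its polarization classes into hyperplane classes, Lieberman's `B(A)` moving the degree inside the kernel. No Chern character theory,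
no twisted door on this axis. [cite: Bloch1972Semiregularity, Thm. (7.4) and Remark (7.5) (p. 65)] [cite: Andre1996Motifs, §6.3 Lemmes 6.3.2–6.3.3 (pp. 32–33)]
[cite: Andre1992HodgeCM, Théorème] [cite: Deligne1982HodgeCycles, §4 proof of Thm. 4.8] [cite: Lieberman1968, main theorem] [cite: Milne1999, §7 p. 72] -/
theorem HC_CM_of_kodaira_of_bloch_of_throughSplitAnchor_of_oneSplitWeilAnchorBlochCarriersAll (hK : Kodaira1954_rationalKaehlerClass_eq_hyperplaneClass)
    (h : andre1996_weilLineFamily_throughSplitAnchor) (hBl : ∀ n q : ℕ, BlochSemiregularSpreadOfSubscheme n q) (hall : OneSplitWeilAnchorBlochCarriersAll) :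
    RankFourFaces.CMAbelianHodge :=
  fun B hB' hcm ↦ cmHodgeHypothesisAt_of_kodaira_of_andreSplitWeilClasses hK
    (andreSplitWeilClasses_of_throughSplitAnchor_of_bloch_of_oneSplitWeilAnchorBlochCarriersAll h hBl hall) B hB' hcm

/-! ## §2 `HC_AV` with `HC_CM` idle — the André column's `B_min` of gen 65, Bloch form -/

/-- **`HC_AV ⟸ K-C ∧ TwistedPerfectDoor ∧ Kodaira ∧ AndreCMAnchoredPencil ∧ the family fact ∧ (Bloch (7.4) at every `(n, q)`) ∧ CMAlgebraicTwistedCarriers ∧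
OneSplitWeilAnchorBlochCarriersAll`** — THE ANDRÉ COLUMN'S `B_min` OF GEN 65, BLOCH FORM (`HC_CM` IDLE): besides the road's binders (K-C, the twisted door — used on the
CM axis (i) only — and Lemme 6.3.1), Kodaira's embedding theorem, the André∕Deligne family fact and Bloch's semiregularity theorem (all theorems in print), TWO carrier
statements — (i) semiregular twisted representatives, modulo the `θ`-ray, of KNOWN ALGEBRAIC classes of codimension `2 ≤ p`, `2p + 4 ≤ n` on polarised CM abelian
`n`-folds, and (ii) per inhabited type `(E, p)`, `p ≥ 2`, ONE split anchor of our choice at every chart of which some non-zero rational `E`-Weil class `w` gives, for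
some shift `j`, a Bloch-semiregular l.c.i. of codimension `p + j` and class `a·θʲw + b·θ^{p+j}`. [cite: Andre1996Motifs, §6.3 (pp. 31–33)] [cite: Andre1992HodgeCM, Théorème]
[cite: Bloch1972Semiregularity, Thm. (7.4) and Remark (7.5) (p. 65)] [cite: Deligne1982HodgeCycles, §4 proof of Thm. 4.8] [cite: Lieberman1968, main theorem]
[cite: Pridham2024Semiregularity, Cor. 2.25 and Rem. 2.26–2.27] -/
theorem HC_AV_of_kodaira_of_bloch_of_cmAlgebraic_and_oneSplitWeilAnchorBlochCarriers (hC : VHCAbelianSchemesRoad.ChernCharacterOnBetti)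
    (hDoor : VHCAbelianSchemesRoad.TwistedPerfectDoor) (hK : Kodaira1954_rationalKaehlerClass_eq_hyperplaneClass) (h₂₁ : VHCAbelianSchemesRoad.AndreCMAnchoredPencil)
    (h : andre1996_weilLineFamily_throughSplitAnchor) (hBl : ∀ n q : ℕ, BlochSemiregularSpreadOfSubscheme n q) (hcm : CMAlgebraicTwistedCarriers)
    (hall : OneSplitWeilAnchorBlochCarriersAll) : PadicSemiregularLift.HodgeAbelianVarieties := by
  have hS := andreSplitWeilClasses_of_throughSplitAnchor_of_bloch_of_oneSplitWeilAnchorBlochCarriersAll h hBl hall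
  obtain ⟨C⟩ := (hC : Nonempty ChernCharacterBetti)
  exact fun A ↦ forall_hodgeConjectureFor_of_kodaira_of_andre1996_of_andreSplitWeilClasses_of_door_of_cmAlgebraic h₂₁ hK
    ((twistedPerfectDoorVHC_iff_localVariationalHodgeFor C _).1 (hDoor C)) (fun n p h2 h4 ↦ hcm C n p h2 h4) hS A

/-! ## §3 Both axes at once -/

/-- **Both axes at once**: Kodaira ∧ the family fact ∧ (Bloch (7.4) at every `(n, q)`) ∧ `OneSplitWeilAnchorBlochCarriersAll` ⟹ `HC_CM ∧ AndreSplitWeilClasses`.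
[cite: Bloch1972Semiregularity, Thm. (7.4) and Remark (7.5) (p. 65)] [cite: Andre1996Motifs, §6.3 (pp. 32–33)] [cite: Andre1992HodgeCM, Théorème] -/
theorem HC_CM_and_andreSplitWeilClasses_of_bloch_of_oneSplitWeilAnchorBlochCarriersAll (hK : Kodaira1954_rationalKaehlerClass_eq_hyperplaneClass)
    (h : andre1996_weilLineFamily_throughSplitAnchor) (hBl : ∀ n q : ℕ, BlochSemiregularSpreadOfSubscheme n q) (hall : OneSplitWeilAnchorBlochCarriersAll) :
    RankFourFaces.CMAbelianHodge ∧ AndreSplitWeilClasses :=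
  ⟨HC_CM_of_kodaira_of_bloch_of_throughSplitAnchor_of_oneSplitWeilAnchorBlochCarriersAll hK h hBl hall,
    andreSplitWeilClasses_of_throughSplitAnchor_of_bloch_of_oneSplitWeilAnchorBlochCarriersAll h hBl hall⟩

end Summit.HodgeConjecture.HodgeConjecture.Ring2.AbelianAll

end
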